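import Literature.IUT.LogVolume.LambdaLineGalois
import Literature.IUT.LogVolume.Corollary22Legendre
import HarnessLib

/-!
# The `λ`-line over the `j`-line has degree `≤ 6`: `[F_tpd : F_mod] ≤ 6`, `[F_tpd : ℚ] ≤ 6·d_mod`

Mochizuki, *Inter-universal Teichmüller theory IV*, RIMS manuscript (Apr. 2020; = PRIMS **57** (2021)),
Thm. 1.10 p. 22: "`d_mod := [F_mod : ℚ]` … `d*_mod := 2^12·3^3·5·d_mod`", where the factor
`2^12·3^3·5 = 6 · 46080` bounds `[F : F_mod] = [F : F_tpd]·[F_tpd : F_mod]` with `[F : F_tpd] ∣ 2·48·480 = 46080`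
(Step (ii), p. 24: `Gal(F/F_tpd) ↪ GL₂(𝔽₃) × GL₂(𝔽₅) × ℤ/2ℤ`) and `[F_tpd : F_mod] ≤ |GL₂(𝔽₂)| = 6`
(`F_tpd := F_mod(E_{F_mod}[2])`, p. 22). In the tree's model of the `λ`-line
(`F_tpd = ℚ(λ)` = `P.F` for `P ∈ UP`, `F_mod = ℚ(j(λ))`, `Corollary22Legendre.dmod`) this is the classical
degree bound PROVED here from abc-iut-S3's fibre polynomial (`LambdaLineGalois.lean`): `λ` is a root of
`anharmonicPoly j(λ) ∈ F_mod[X]`, of degree `≤ 6`, and generates `F_tpd` over `F_mod`.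

* `natDegree_anharmonicPoly_le` — the fibre polynomial has degree `≤ 6`;
* `adjoin_jMod_x_eq_top` — `F_tpd = F_mod(λ)`;
* `finrank_adjoin_jInv_le_six` — **`[F_tpd : F_mod] ≤ 6`**;
* `dmod_mul_finrank_eq_degree`, `dmod_dvd_degree`, `degree_le_six_mul_dmod` — `[F_tpd : ℚ] = d_mod·[F_tpd : F_mod]`,
  so `d_mod ∣ [F_tpd : ℚ] ≤ 6·d_mod`.

Proof-only companion (no new definition, no named fact); classical field theory; TAKES NO SIDE on
anything disputed.
-/

noncomputable section

namespace Literature.IUT.LogVolume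

namespace Cor22

open Polynomial IntermediateField Literature.NumberTheory.DiophantineGeometry.GenEll

/-- The fibre polynomial `256·(X²−X+1)³ − j·X²(X−1)²` has degree `≤ 6`.
[cite: Mochizuki2012, IUTchIV Thm 1.10 p.22] -/
theorem natDegree_anharmonicPoly_le {K : Type*} [CommRing K] (j : K) :
    (anharmonicPoly j).natDegree ≤ 6 := by
  unfold anharmonicPoly
  compute_degree

/-- `F_tpd = F_mod(λ)`: `λ` generates `P.F` over `F_mod = ℚ(j(λ))` (indeed already over `ℚ`, `P ∈ UP`).
[cite: Mochizuki2012, IUTchIV Thm 1.10 p.22] -/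
theorem adjoin_jMod_x_eq_top (P : NFPoint) (hP : P ∈ UP) :
    IntermediateField.adjoin (IntermediateField.adjoin ℚ ({jInv P.x} : Set P.F)) ({P.x} : Set P.F) = ⊤ := by
  set J := IntermediateField.adjoin ℚ ({jInv P.x} : Set P.F) with hJ
  apply IntermediateField.restrictScalars_injective ℚ
  rw [IntermediateField.restrictScalars_top, eq_top_iff]
  have h : IntermediateField.adjoin ℚ ({P.x} : Set P.F) = ⊤ := hP.2
  rw [← h]
  refine IntermediateField.adjoin_le_iff.mpr ?_
  intro y hy
  rw [Set.mem_singleton_iff] at hy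
  subst hy
  exact IntermediateField.subset_adjoin J ({P.x} : Set P.F) (Set.mem_singleton _)

/-- **`[F_tpd : F_mod] ≤ 6`**: the `λ`-line has degree at most `6` over the `j`-line
(`λ` is a root of the degree-`6` fibre polynomial of `j(λ)` over `ℚ(j(λ))` and generates `ℚ(λ)`).
[cite: Mochizuki2012, IUTchIV Thm 1.10 p.22] -/
theorem finrank_adjoin_jInv_le_six (P : NFPoint) (hP : P ∈ UP) :
    Module.finrank (IntermediateField.adjoin ℚ ({jInv P.x} : Set P.F)) P.F ≤ 6 := by
  set J := IntermediateField.adjoin ℚ ({jInv P.x} : Set P.F) with hJ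
  have h0 : P.x ≠ 0 := hP.1.1
  have h1 : P.x ≠ 1 := hP.1.2
  haveI : Module.Finite J P.F := Module.Finite.of_restrictScalars_finite ℚ J P.F
  have hint : IsIntegral J P.x := Algebra.IsIntegral.isIntegral P.x
  -- `[F_tpd : F_mod] = [F_mod(λ) : F_mod] = deg (minpoly_{F_mod} λ)`
  have htop := adjoin_jMod_x_eq_top P hP
  have hfin : Module.finrank J P.F = (minpoly J P.x).natDegree := by
    rw [← IntermediateField.adjoin.finrank hint, htop, IntermediateField.finrank_top']
  -- `minpoly_{F_mod} λ ∣`-bound: `λ` is a root of the fibre polynomial of degree `≤ 6`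
  have hmap : (anharmonicPoly (jMod P)).map (algebraMap J P.F) = anharmonicPoly (jInv P.x) := by
    rw [map_anharmonicPoly]; rfl
  have hroot : Polynomial.aeval P.x (anharmonicPoly (jMod P)) = 0 := by
    rw [← Polynomial.eval_map_algebraMap, hmap]
    exact eval_anharmonicPoly_jInv_self h0 h1
  have hne : anharmonicPoly (jMod P) ≠ 0 := anharmonicPoly_ne_zero _
  have hdeg : (minpoly J P.x).natDegree ≤ (anharmonicPoly (jMod P)).natDegree :=
    Polynomial.natDegree_le_natDegree (minpoly.degree_le_of_ne_zero J P.x hne hroot)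
  rw [hfin]
  exact hdeg.trans (natDegree_anharmonicPoly_le _)

/-- Tower law `[F_tpd : ℚ] = d_mod · [F_tpd : F_mod]`. [cite: Mochizuki2012, IUTchIV Thm 1.10 p.22] -/
theorem dmod_mul_finrank_eq_degree (P : NFPoint) :
    dmod P * Module.finrank (IntermediateField.adjoin ℚ ({jInv P.x} : Set P.F)) P.F = P.degree := by
  unfold dmod NFPoint.degree
  exact Module.finrank_mul_finrank ℚ _ P.F

/-- `d_mod ∣ [F_tpd : ℚ]`. [cite: Mochizuki2012, IUTchIV Thm 1.10 p.22] -/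
theorem dmod_dvd_degree (P : NFPoint) : dmod P ∣ P.degree :=
  Dvd.intro _ (dmod_mul_finrank_eq_degree P)

/-- **`[F_tpd : ℚ] ≤ 6·d_mod`** for `λ ∈ U_P(ℚ̄)` presented over its minimal field
(`d_mod·[F_tpd : F_mod]` with `[F_tpd : F_mod] ≤ 6`). [cite: Mochizuki2012, IUTchIV Thm 1.10 p.22] -/
theorem degree_le_six_mul_dmod (P : NFPoint) (hP : P ∈ UP) : P.degree ≤ 6 * dmod P := by
  rw [← dmod_mul_finrank_eq_degree P, mul_comm]
  exact Nat.mul_le_mul_right _ (finrank_adjoin_jInv_le_six P hP)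

end Cor22

end Literature.IUT.LogVolume

end
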